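import Summits.ResolutionOfSingularities.ResolutionOfSingularities.Theorems.PurelyInseparableDim4UniformSources
import HarnessLib

/-!
# [OURS · res-dim4-pi · F4-C-loc] PARAMETRIC LIFT KIT: term lists in the four chart letters AND ONE FIBRE LETTER `t`,
  specialised at `t = β ∈ L` — the data calculus behind all-fields certificates whose rows are one-parameter FAMILIES
  of states (B's free fibre coordinate as a letter)

Cell `res-dim4-pi` (D-0157 DOOR 2, wave 2), seat `res-dim4-p-6` g3.  `…HopRegionsLocalCertUniform` (p674680) proved
that at LOOP-D's root `d0` and at F3's `fc3` every first move of A leaves B a whole fibre LINE of replies over every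
field, so no table of `𝔽₃`-rational rows reaches the two roots.  The reply `b = β·δᵢ` (`β ∈ L` arbitrary) produces
the child `clean (τ_β^{(i)} G)` — a state whose coefficients are polynomials in `β`.  This file is the `decide`-able
calculus for such states: `StepKit.Terms 5 k` (index `4` = the letter `t`), the specialisation
**`spec f β : MvPolynomial (Fin 5) k →+* MvPolynomial (Fin 4) K`** (`xᵢ ↦ xᵢ`, `t ↦ β`, coefficients along
`f : k →+* K`), and the transfer lemmas a certificate checker needs:

* §1 `spec`, `spec_monomial`; t-free lists (`tfreeB`, `spec_eq_of_tfree`, `trunc`/`spec_eq_map_trunc`, `embed`/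
  `spec_embed`) — the rational rows are the t-free ones;
* §2 the chart transform (`chartTransform_spec`, chart letters `S.map castSucc`), cleaning on the four chart letters
  (`clean4`, `deletePthPowers_spec`), permissibility from the data (`ppermB`, `isPermissibleCentre_spec` — sound for
  EVERY `β`: the support of the specialisation lies under the listed x-exponents);
* §3 translations: by the chart origin (`translate_zero`, tree), by a RATIONAL value `xᵢ ↦ xᵢ + ρ`
  (`translate_single_map_spec`, the tree's `StepKit.tau`/`transVar` at five letters) and by THE LETTER ITSELF
  `xᵢ ↦ xᵢ + t` (**`shearAlg`/`shearL`/`shearAlg_evalT`**, binomial theorem on term lists, and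
  **`translate_single_spec`**: `translate (β·δᵢ) ∘ spec f β = spec f β ∘ shear i`);
* (sequel `…ParamLiftSources`: the Taylor coefficient of `x^γ` at a point `b` as a list sum and the three
  certificate checks witness / forcing / root built on it.)

[OURS · counted 0 · instrument (data calculus); AI kernel work, weaker than expert review.]  NOTHING here is a statement about resolution of singularities;
resolution in dimension `≥ 4` / characteristic `p > 0` is NOT proved by anything in this file.  bears_on:
LADDER-RESOLUTION:D157-DOOR2 (res-dim4-pi · F4-C-loc all fields · parametric rows).  Host item (DR-157-C):
`stmt-ResolutionOfSingularities-16155`, helper.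
-/

set_option linter.dupNamespace false -- mandated namespace of this single-conjunct summit

noncomputable section

open MvPolynomial Finset
open scoped BigOperators

namespace Summit.ResolutionOfSingularities.ResolutionOfSingularities.Theorems.PIDim4

namespace ParamLift

open Literature.AlgebraicGeometry.Resolution
open Literature.AlgebraicGeometry.Resolution.Hauser2010
open Literature.AlgebraicGeometry.Resolution.CentreBlowup
open StepKit

variable {k K : Type} [Field k] [Field K] [DecidableEq k] [DecidableEq K] (f : k →+* K) (β : K)

/-! ## §1 Specialisation of the fibre letter -/

/-- the images of the five letters: `xᵢ ↦ xᵢ` (`i < 4`), `t ↦ β`. OURS. [folklore] -/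
def specVar (β : K) : Fin 5 → MvPolynomial (Fin 4) K := Fin.snoc (fun i : Fin 4 => X i) (C β)

omit [DecidableEq K] in
/-- a chart letter goes to itself. OURS. [folklore] -/
@[simp] theorem specVar_castSucc (i : Fin 4) : specVar β i.castSucc = X i := by
  simp [specVar]

omit [DecidableEq K] in
/-- the fibre letter goes to `β`. OURS. [folklore] -/
@[simp] theorem specVar_last : specVar β (Fin.last 4) = C β := by
  simp only [specVar]; exact Fin.snoc_last _ _

/-- **specialisation** `spec f β : k[x₁..x₄, t] → K[x₁..x₄]`, `t ↦ β`, coefficients along `f`. OURS. [folklore] -/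
def spec : MvPolynomial (Fin 5) k →+* MvPolynomial (Fin 4) K := eval₂Hom (C.comp f) (specVar β)

omit [DecidableEq k] [DecidableEq K] in
/-- `spec` on constants. OURS. [folklore] -/
@[simp] theorem spec_C (c : k) : spec f β (C c) = C (f c) := by
  simp [spec]

omit [DecidableEq k] [DecidableEq K] in
/-- `spec` on a chart letter. OURS. [folklore] -/
@[simp] theorem spec_X_castSucc (i : Fin 4) : spec f β (X i.castSucc) = X i := by
  rw [spec, eval₂Hom_X', specVar_castSucc]

omit [DecidableEq k] [DecidableEq K] in
/-- `spec` on the fibre letter. OURS. [folklore] -/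
@[simp] theorem spec_X_last : spec f β (X (Fin.last 4)) = C β := by
  rw [spec, eval₂Hom_X', specVar_last]

omit [DecidableEq k] [DecidableEq K] in
/-- **`spec` on a monomial**: `c·x^e·t^a ↦ f(c)β^a · x^e`. OURS. [folklore] -/
theorem spec_monomial (e : Fin 5 → ℕ) (c : k) :
    spec f β (monomial (expo e) c) = C (f c * β ^ e (Fin.last 4)) * monomial (expo (Fin.init e)) 1 := by
  rw [monomial_expo_eq, map_mul, spec_C, map_prod, Fin.prod_univ_castSucc, monomial_expo_eq, C_1, one_mul,
    map_mul, C_pow]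
  simp_rw [map_pow, spec_X_castSucc, spec_X_last]
  simp only [Fin.init]
  ring

/-- a term list is **t-free** (a rational row): no term carries the fibre letter. OURS. [folklore] -/
def tfreeB (L : Terms 5 k) : Bool := L.all fun t => decide (t.1 (Fin.last 4) = 0)

omit [DecidableEq k] [DecidableEq K] in
/-- a t-free list specialises independently of `β`. OURS. [folklore] -/
theorem spec_eq_of_tfree {L : Terms 5 k} (h : tfreeB L = true) (β β' : K) :
    spec f β (evalT L) = spec f β' (evalT L) := by
  induction L with
  | nil => simp
  | cons t L ih =>
    simp only [tfreeB, List.all_cons, Bool.and_eq_true, decide_eq_true_eq] at h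
    have ih' := ih (by simpa [tfreeB] using h.2)
    rw [evalT_cons, map_add, map_add, ih', spec_monomial, spec_monomial, h.1, pow_zero, pow_zero]

/-- forgetting the fibre letter. OURS. [folklore] -/
def trunc (L : Terms 5 k) : Terms 4 k := L.map fun t => (Fin.init t.1, t.2)

omit [DecidableEq k] [DecidableEq K] in
/-- **a t-free list specialises to the coefficient-mapped truncation** (the rational case). OURS. [folklore] -/
theorem spec_eq_map_trunc {L : Terms 5 k} (h : tfreeB L = true) :
    spec f β (evalT L) = MvPolynomial.map f (evalT (trunc L)) := by
  induction L with
  | nil => simp [trunc]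
  | cons t L ih =>
    simp only [tfreeB, List.all_cons, Bool.and_eq_true, decide_eq_true_eq] at h
    have ih' := ih (by simpa [tfreeB] using h.2)
    simp only [trunc, List.map_cons, evalT_cons, map_add] at ih' ⊢
    rw [ih', spec_monomial, h.1, pow_zero, mul_one, map_monomial, C_mul_monomial, mul_one]

/-- adjoining the fibre letter with exponent `0`. OURS. [folklore] -/
def embed (L : Terms 4 k) : Terms 5 k := L.map fun t => (Fin.snoc t.1 0, t.2)

omit [Field k] [DecidableEq k] in
/-- `embed` is t-free. OURS. [folklore] -/
theorem tfreeB_embed (L : Terms 4 k) : tfreeB (embed L) = true := by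
  simp only [tfreeB, embed, List.all_map, List.all_eq_true, Function.comp_apply, decide_eq_true_eq]
  intro t _
  exact Fin.snoc_last _ _

omit [Field k] [DecidableEq k] in
/-- `trunc ∘ embed = id`. OURS. [folklore] -/
theorem trunc_embed (L : Terms 4 k) : trunc (embed L) = L := by
  unfold trunc embed
  rw [List.map_map]
  have h : ((fun t : (Fin 5 → ℕ) × k => (Fin.init t.1, t.2)) ∘ fun t : (Fin 4 → ℕ) × k => (Fin.snoc t.1 0, t.2)) =
      id := by
    funext t; simp [Fin.init_snoc]
  rw [h, List.map_id]

omit [DecidableEq k] [DecidableEq K] in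
/-- **the rational lift is the specialised embedding** (any `β`). OURS. [folklore] -/
theorem spec_embed (L : Terms 4 k) : spec f β (evalT (embed L)) = MvPolynomial.map f (evalT L) := by
  rw [spec_eq_map_trunc f β (tfreeB_embed L), trunc_embed]

/-! ## §2 Chart transform, cleaning, permissibility -/

/-- the chart letters inside the five letters. OURS. [folklore] -/
def S5 (S : Finset (Fin 4)) : Finset (Fin 5) := S.map Fin.castSuccEmb

omit [DecidableEq k] in
/-- the five-letter chart law restricted to the chart letters is the four-letter chart law, and it fixes the
exponent of `t`. OURS. [folklore] -/
theorem init_chartE (q : ℕ) (S : Finset (Fin 4)) (j : Fin 4) (e : Fin 5 → ℕ) :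
    Fin.init (chartE q (S5 S) j.castSucc e) = chartE q S j (Fin.init e) ∧
      chartE q (S5 S) j.castSucc e (Fin.last 4) = e (Fin.last 4) := by
  constructor
  · funext i
    simp only [Fin.init, chartE, S5, Finset.sum_map, Fin.coe_castSuccEmb]
    by_cases h : i = j
    · subst h; rw [Function.update_self, Function.update_self]
    · rw [Function.update_of_ne (fun h' => h (Fin.castSucc_injective _ h')), Function.update_of_ne h]
      rfl
  · rw [chartE, Function.update_of_ne (Fin.castSucc_lt_last j).ne']

omit [DecidableEq k] [DecidableEq K] in
/-- **the chart transform commutes with the specialisation** (chart letters only). OURS. [folklore] -/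
theorem chartTransform_spec (q : ℕ) (S : Finset (Fin 4)) (j : Fin 4) (L : Terms 5 k) :
    chartTransform q S j (spec f β (evalT L)) = spec f β (evalT (chartL q (S5 S) j.castSucc L)) := by
  induction L with
  | nil => simp [chartL, chartTransform_zero]
  | cons t L ih =>
    simp only [chartL, List.map_cons, evalT_cons, map_add] at ih ⊢
    rw [chartTransform_add, ih, spec_monomial, spec_monomial, chartTransform_C_mul, chartTransform_monomial,
      ← expo_chartE, (init_chartE q S j t.1).1, (init_chartE q S j t.1).2]

/-- cleaning on the four chart letters: drop the terms `c·x^e·t^a` with `q ∣ eᵢ` for every chart letter.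
OURS. [folklore] -/
def clean4 (q : ℕ) (L : Terms 5 k) : Terms 5 k := L.filter fun t => !decide (∀ i : Fin 4, q ∣ t.1 i.castSucc)

omit [DecidableEq k] [DecidableEq K] in
/-- **cleaning commutes with the specialisation.** OURS. [folklore] -/
theorem deletePthPowers_spec (q : ℕ) (L : Terms 5 k) :
    deletePthPowers q (spec f β (evalT L)) = spec f β (evalT (clean4 q L)) := by
  induction L with
  | nil => simp [clean4, deletePthPowers_zero]
  | cons t L ih =>
    simp only [clean4, List.filter_cons] at ih ⊢
    rw [evalT_cons, map_add, deletePthPowers_add, ih, spec_monomial, C_mul_monomial, mul_one,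
      deletePthPowers_monomial]
    by_cases h : ∀ i : Fin 4, q ∣ t.1 i.castSucc
    · rw [if_pos ((isPthPowerExponent_expo_iff q (Fin.init t.1)).mpr h), zero_add]
      simp [h]
    · rw [if_neg (mt (isPthPowerExponent_expo_iff q (Fin.init t.1)).mp h)]
      simp only [h, decide_false, Bool.not_false, ite_true, evalT_cons, map_add]
      rw [spec_monomial, C_mul_monomial, mul_one]

/-- permissibility from the data: `S ≠ ∅` and every LISTED term has `S`-degree `≥ q` (sound for every `β`).
OURS. [folklore] -/
def ppermB (q : ℕ) (S : Finset (Fin 4)) (L : Terms 5 k) : Bool :=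
  decide S.Nonempty && L.all fun t => decide (q ≤ ∑ i ∈ S, t.1 i.castSucc)

omit [DecidableEq k] [DecidableEq K] in
/-- the support of a specialisation lies under the listed x-exponents. OURS. [folklore] -/
theorem support_spec_evalT {L : Terms 5 k} {d : Fin 4 →₀ ℕ} (hd : d ∈ (spec f β (evalT L)).support) :
    ∃ t ∈ L, d = expo (Fin.init t.1) := by
  induction L with
  | nil => simp at hd
  | cons t L ih =>
    rw [evalT_cons, map_add, spec_monomial, C_mul_monomial, mul_one] at hd
    rcases Finset.mem_union.mp (support_add hd) with h | h
    · exact ⟨t, List.mem_cons_self, by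
        have := support_monomial_subset h
        rwa [Finset.mem_singleton] at this⟩
    · obtain ⟨t', ht', hd'⟩ := ih h
      exact ⟨t', List.mem_cons_of_mem _ ht', hd'⟩

omit [DecidableEq k] [DecidableEq K] in
/-- **permissibility goes up from the data**, for every value of the fibre letter. OURS. [folklore] -/
theorem isPermissibleCentre_spec {q : ℕ} {S : Finset (Fin 4)} {L : Terms 5 k} (h : ppermB q S L = true) :
    IsPermissibleCentre q S (spec f β (evalT L)) := by
  simp only [ppermB, Bool.and_eq_true, decide_eq_true_eq, List.all_eq_true] at h
  refine ⟨h.1, ?_⟩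
  unfold ordAlong
  refine Finset.le_inf fun d hd => ?_
  obtain ⟨t, ht, rfl⟩ := support_spec_evalT f β hd
  rw [degIn_expo]
  exact_mod_cast h.2 t ht

/-! ## §3 Translations: origin, rational values, the letter itself -/

/-- the substitution `xᵢ ↦ xᵢ + t` (B's free fibre coordinate becomes the letter). OURS. [folklore] -/
def shearAlg (i : Fin 4) : MvPolynomial (Fin 5) k →ₐ[k] MvPolynomial (Fin 5) k :=
  aeval (Function.update X i.castSucc (X i.castSucc + X (Fin.last 4)))

omit [DecidableEq k] in
/-- `shearAlg` fixes constants. OURS. [folklore] -/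
theorem shearAlg_C (i : Fin 4) (c : k) : shearAlg i (C c) = (C c : MvPolynomial (Fin 5) k) := by
  rw [shearAlg, aeval_C, algebraMap_eq]

omit [DecidableEq k] in
/-- `shearAlg` on a letter. OURS. [folklore] -/
theorem shearAlg_X (i : Fin 4) (m : Fin 5) :
    shearAlg i (X m) = if m = i.castSucc then X i.castSucc + X (Fin.last 4) else (X m : MvPolynomial (Fin 5) k) := by
  rw [shearAlg, aeval_X, Function.update_apply]

/-- `shearAlg` on term lists (binomial theorem): `x_i^e ↦ Σ_l C(e,l) x_i^l t^{e−l}`. OURS. [folklore] -/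
def shearL (i : Fin 4) (L : Terms 5 k) : Terms 5 k :=
  L.flatMap fun t => (List.range (t.1 i.castSucc + 1)).map fun l =>
    (Function.update (Function.update t.1 i.castSucc l) (Fin.last 4) (t.1 (Fin.last 4) + (t.1 i.castSucc - l)),
      t.2 * ((t.1 i.castSucc).choose l : k))

omit [DecidableEq k] in
/-- the doubly updated monomial. OURS. [folklore] -/
theorem monomial_update_update_eq (e : Fin 5 → ℕ) (i : Fin 4) (l v : ℕ) (c : k) :
    monomial (expo (Function.update (Function.update e i.castSucc l) (Fin.last 4) v)) c =
      C c * (X i.castSucc ^ l * (X (Fin.last 4) ^ v *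
        ∏ m ∈ (univ.erase i.castSucc).erase (Fin.last 4), (X m : MvPolynomial (Fin 5) k) ^ e m)) := by
  have hne : (Fin.last 4 : Fin 5) ≠ i.castSucc := (Fin.castSucc_lt_last i).ne'
  rw [monomial_expo_eq, prod_pow_eq_mul _ i.castSucc,
    ← Finset.mul_prod_erase (univ.erase i.castSucc)
      (fun m => (X m : MvPolynomial (Fin 5) k) ^
        (Function.update (Function.update e i.castSucc l) (Fin.last 4) v) m)
      (Finset.mem_erase.mpr ⟨hne, mem_univ _⟩),
    Function.update_self, Function.update_of_ne hne.symm, Function.update_self]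
  congr 3
  exact Finset.prod_congr rfl fun m hm => by
    rw [Function.update_of_ne (ne_of_mem_erase hm),
      Function.update_of_ne (ne_of_mem_erase (mem_of_mem_erase hm))]

omit [DecidableEq k] in
/-- **`shearAlg` on a monomial** is the binomial expansion. OURS. [folklore] -/
theorem shearAlg_monomial (i : Fin 4) (e : Fin 5 → ℕ) (c : k) :
    shearAlg i (monomial (expo e) c) = evalT ((List.range (e i.castSucc + 1)).map fun l =>
      (Function.update (Function.update e i.castSucc l) (Fin.last 4) (e (Fin.last 4) + (e i.castSucc - l)),
        c * ((e i.castSucc).choose l : k))) := by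
  have hne : (Fin.last 4 : Fin 5) ≠ i.castSucc := (Fin.castSucc_lt_last i).ne'
  rw [evalT_eq_sum, List.map_map, list_sum_range_map, monomial_expo_eq, prod_pow_eq_mul _ i.castSucc, map_mul,
    shearAlg_C, map_mul, map_pow, shearAlg_X, if_pos rfl, map_prod,
    ← Finset.mul_prod_erase (univ.erase i.castSucc) _ (Finset.mem_erase.mpr ⟨hne, mem_univ _⟩)]
  have hfix : (∏ m ∈ (univ.erase i.castSucc).erase (Fin.last 4),
      shearAlg i ((X m : MvPolynomial (Fin 5) k) ^ e m)) =
      ∏ m ∈ (univ.erase i.castSucc).erase (Fin.last 4), (X m : MvPolynomial (Fin 5) k) ^ e m :=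
    Finset.prod_congr rfl fun m hm => by
      rw [map_pow, shearAlg_X, if_neg (ne_of_mem_erase (mem_of_mem_erase hm))]
  rw [hfix, map_pow, shearAlg_X, if_neg hne, add_pow, Finset.sum_mul, Finset.mul_sum]
  refine Finset.sum_congr rfl fun l _ => ?_
  simp only [Function.comp_apply]
  rw [monomial_update_update_eq, map_mul, map_natCast, pow_add]
  ring

omit [DecidableEq k] in
/-- **`shearAlg` on a presented polynomial is `shearL`.** OURS. [folklore] -/
theorem shearAlg_evalT (i : Fin 4) (L : Terms 5 k) : shearAlg i (evalT L) = evalT (shearL i L) := by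
  induction L with
  | nil => simp [shearL]
  | cons t L ih =>
    simp only [shearL, List.flatMap_cons] at ih ⊢
    rw [evalT_cons, map_add, ih, shearAlg_monomial, evalT_append]

omit [DecidableEq k] [DecidableEq K] in
/-- **translation by the letter**: `translate (β·δᵢ) ∘ spec f β = spec f β ∘ shearAlg i`. OURS. [folklore] -/
theorem translate_single_spec (i : Fin 4) (P : MvPolynomial (Fin 5) k) :
    PointBlowup.translate (Pi.single i β) (spec f β P) = spec f β (shearAlg i P) := by
  have key : ((PointBlowup.translate (Pi.single i β) : MvPolynomial (Fin 4) K → MvPolynomial (Fin 4) K) ∘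
      spec f β) = (spec f β ∘ shearAlg i : MvPolynomial (Fin 5) k → MvPolynomial (Fin 4) K) := by
    have h1 : (aeval fun m : Fin 4 => (X m + C (Pi.single i β m) : MvPolynomial (Fin 4) K)).toRingHom.comp
        (spec f β) = (spec f β).comp (shearAlg i (k := k)).toRingHom := by
      refine MvPolynomial.ringHom_ext (fun c => ?_) (fun m => ?_)
      · simp [spec, shearAlg]
      · rw [RingHom.comp_apply, RingHom.comp_apply]
        show aeval _ (spec f β (X m)) = spec f β (shearAlg i (X m))
        rw [shearAlg_X]
        induction m using Fin.lastCases with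
        | last =>
          rw [spec_X_last, aeval_C, algebraMap_eq, if_neg (Fin.castSucc_lt_last i).ne', spec_X_last]
        | cast m =>
          rw [spec_X_castSucc, aeval_X]
          by_cases hm : m = i
          · subst hm; rw [if_pos rfl, map_add, spec_X_castSucc, spec_X_last, Pi.single_eq_same]
          · rw [if_neg (fun h => hm (Fin.castSucc_injective _ h)), spec_X_castSucc, Pi.single_eq_of_ne hm,
              C_0, add_zero]
    funext P
    exact congrArg (fun φ : MvPolynomial (Fin 5) k →+* MvPolynomial (Fin 4) K => φ P) h1
  exact congrFun key P

omit [DecidableEq k] [DecidableEq K] in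
/-- **translation by a rational value**: `translate (f ρ·δᵢ) ∘ spec f β = spec f β ∘ tau ᵢ ρ`. OURS. [folklore] -/
theorem translate_single_map_spec (i : Fin 4) (ρ : k) (P : MvPolynomial (Fin 5) k) :
    PointBlowup.translate (Pi.single i (f ρ)) (spec f β P) = spec f β (tau i.castSucc ρ P) := by
  have h1 : (aeval fun m : Fin 4 => (X m + C (Pi.single i (f ρ) m) : MvPolynomial (Fin 4) K)).toRingHom.comp
      (spec f β) = (spec f β).comp (tau i.castSucc ρ (R := k)).toRingHom := by
    refine MvPolynomial.ringHom_ext (fun c => ?_) (fun m => ?_)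
    · simp [spec, tau]
    · rw [RingHom.comp_apply, RingHom.comp_apply]
      show aeval _ (spec f β (X m)) = spec f β (tau i.castSucc ρ (X m))
      rw [tau_X]
      induction m using Fin.lastCases with
      | last =>
        rw [spec_X_last, aeval_C, algebraMap_eq, if_neg (Fin.castSucc_lt_last i).ne', spec_X_last]
      | cast m =>
        rw [spec_X_castSucc, aeval_X]
        by_cases hm : m = i
        · subst hm; rw [if_pos rfl, map_add, spec_X_castSucc, spec_C, Pi.single_eq_same]
        · rw [if_neg (fun h => hm (Fin.castSucc_injective _ h)), spec_X_castSucc, Pi.single_eq_of_ne hm,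
            C_0, add_zero]
  exact congrArg (fun φ : MvPolynomial (Fin 5) k →+* MvPolynomial (Fin 4) K => φ P) h1

end ParamLift

end Summit.ResolutionOfSingularities.ResolutionOfSingularities.Theorems.PIDim4

end
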